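import Literature.AlgebraicGeometry.Motives.CartierDivisorDescentAlongFreeQuotient
import Literature.AlgebraicGeometry.AbelianSchemes.AbelianSchemeQuotientMulNDescent
import Literature.AlgebraicGeometry.AbelianSchemes.AbelianSchemeConstSubgroupQuotientGroupLaw
import Literature.AlgebraicGeometry.AbelianSchemes.AbelianSchemeConstSubgroupQuotientSmooth
import Literature.AlgebraicGeometry.AbelianSchemes.AbelianSchemeConstSubgroupStableCoverOfQuasiProjective
import Literature.AlgebraicGeometry.AbelianSchemes.AbelianSchemeOverField
import Literature.AlgebraicGeometry.Motives.AlgPointsMapSurjectiveAlgClosed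
import Literature.AlgebraicGeometry.Motives.BijectiveMorphismIsoGeneral
import Literature.AlgebraicGeometry.Motives.AbelianVarietyQuotientFree
import Literature.AlgebraicGeometry.Motives.AbelianVarietyTorsionPointsCountProofs
import Literature.AlgebraicGeometry.Motives.AbelianVarietyProjectiveChart
import Literature.AlgebraicGeometry.Motives.AbelianVarietyDegree
import HarnessLib

/-!
# An effective divisor invariant under the `2`-torsion translations descends through `[2]` (Mumford §23 Thm. 3, n = 2)

Layer `Literature/AlgebraicGeometry/AbelianVarieties`, namespace `Literature.AlgebraicGeometry.AbelianVarieties` (auxiliary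
lemmas) with the head declared in `Literature.AlgebraicGeometry.Motives.AbelianVariety` (dot notation on `A`).
THEOREMS ONLY (no definition, no named fact, no instance, no `sorry`).

Setting: an abelian variety `A` over an algebraically closed field `Ω` of characteristic `0`, an EFFECTIVE Cartier divisor `E`
on `A` which is invariant AS A DIVISOR under the translations `t_x` by all `2`-torsion points `x ∈ A[2](Ω)`
(`(E.pullback t_x).SameDivisor E`; e.g. the theta-function divisor `E = 2N•Θ + div w` of ★ G1
`AbelianVarieties/TranslationEigenDivisor`).  [MumfordAV1970] §23 Thm. 3 (p. 231) at `n = 2`, second half, reads: such an `E`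
is `[2]^*Θ₀`; we prove it in the form

* **`AbelianVariety.exists_linEquiv_pullback_two_of_forall_twoTorsion_sameDivisor`** — `∃ Θ₀, ([2]^*Θ₀).LinEquiv E`, with
  `[2] = Hom.toSchemeHom ((2 : ℤ) • 𝟙 A)` (the ★ Kummer files' spelling; its `IsDominant` instance is taken as a binder, as in ★
  G3 `NeronSeveriHalfOfTwoTorsionInvariant`).

Road ([MumfordAV1970] §7 Thm. 4 and §12 Thm. 1): view `A` as an abelian scheme over `S = Spec Ω` (★ `AbelianSchemeOver.ofAbelianVariety`),
let `K ≤ A(S)` be the (finite) group of `2`-torsion SECTIONS (§1: sections ↔ points), `ψ : A → A/K` the ★ quotient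
(`AbelianSchemes/AbelianSchemeConstSubgroupQuotient`: geometric quotient, free, flat, affine — the translations by non-trivial sections
have no fixed geometric points, §2), and descend `E` along `ψ` by ★ `CartierDivisor.exists_sameDivisor_pullback_of_isGeometricQuotient`
(`Motives/CartierDivisorDescentAlongFreeQuotient`) to `E₀` on `A/K` (§4).  The descent `π : A/K → A` of `[2]` (★ `mulNDesc`,
`ψ ≫ π = [2]`) is an ISOMORPHISM (§3): it is bijective on `Ω`-points (onto because `[2]` is, ★ `exists_pow_eq_of_isAlgClosed`;
one-to-one because `x₁² = x₂²` forces `x₁ = t_σ x₂` with `σ = x₁x₂⁻¹ ∈ K`, and `ψ` is `K`-invariant) and proper onto the smooth `A`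
(★ `isIso_of_bijective_of_isProper_of_smooth`, characteristic `0`).  Then `Θ₀ := (π⁻¹)^*E₀` has `[2]^*Θ₀ = ψ^*π^*(π⁻¹)^*E₀ = ψ^*E₀ = E`.

Purpose (cell `hodgecm-mathlib`, D-0151; the (V)-upgrade road (ii-a″) «theta functions without theta groups», file G2 of B-p03 (g17)'s
memo `CENSUS-Vup-HalfOfLambda` §2 (road Q); B-plan1 (g16) 07:53:38Z / 07:57:42Z; seams S1/S2 of B-p03 08:02:05Z): consumed by ★ G3
`AbelianVariety.exists_forall_linEquiv_two_smul` (B-p07 (g17)).  Count-neutral; HC_CM is proved only modulo the 7 printed citations until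
rung 0 closes.

## References
* [MumfordAV1970] D. Mumford, *Abelian Varieties* (1970), §7 Thm. 4 (p. 72), §12 Thm. 1 (p. 112), §23 Thm. 3 (p. 231).
* [MumfordFogartyKirwan1994] D. Mumford, J. Fogarty, F. Kirwan, *Geometric Invariant Theory*, 3rd ed. (1994), Ch. 6 §1 (p. 115), Ch. 7 §2
  Def. 7.1 (p. 129).
* [GortzWedhorn2023] U. Görtz, T. Wedhorn, *Algebraic Geometry II* (2023), (27.35.2), Prop. 27.186 and Prop. 27.187.
-/

set_option autoImplicit false

noncomputable section

-- `(AbelianSchemeOver.ofAbelianVariety A).X` / `.Sections` agree with `A.X` / `𝟙_ ⟶ A.X` by `rfl` only.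
set_option backward.isDefEq.respectTransparency false

universe u

open CategoryTheory CategoryTheory.Limits AlgebraicGeometry MonoidalCategory CartesianMonoidalCategory
open scoped MonObj

namespace Literature.AlgebraicGeometry.AbelianVarieties

open Literature.AlgebraicGeometry.Motives Literature.AlgebraicGeometry.AbelianSchemes
  Literature.AlgebraicGeometry.RelativeSpec

variable {Ω : Type u} [Field Ω]

/-! ## §1 Sections over `Spec Ω` versus `Ω`-points -/

/-- Every `X ⟶ Spec Ω` over `Spec Ω` is THE structure map `toSpecOver X`. [cite: GortzWedhorn2023, (27.35.2)] -/
private theorem eq_toSpecOver' {X : SchemeOver Ω} (g : X ⟶ specOver Ω Ω) : g = toSpecOver X := by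
  ext : 1
  haveI : IsIso (specOver Ω Ω).hom := by
    change IsIso (Spec.map (CommRingCat.ofHom (algebraMap Ω Ω)))
    rw [Algebra.algebraMap_self, CommRingCat.ofHom_id, Spec.map_id]
    infer_instance
  rw [← cancel_mono (specOver Ω Ω).hom, Over.w g, Over.w (toSpecOver X)]

/-- **The section `σ_P : Spec Ω → A` of a point `P ∈ A(Ω)` translates like `P`**: `t_{σ_P} = t_P` for the abelian scheme
`A / Spec Ω` (★ `AbelianSchemeOver.translation`) and the abelian variety `A` (★ `Motives.AbelianVariety.translation`), where
`σ_P := (Spec Ω = 𝟙_ → Spec Ω) ≫ P`. [cite: MumfordFogartyKirwan1994, Ch. 7 §2 Definition 7.1 (p. 129)] -/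
theorem translation_toSpecOver_comp (A : AbelianVariety Ω) (P : A.Points Ω) :
    (AbelianSchemeOver.ofAbelianVariety A).translation (toSpecOver (𝟙_ (SchemeOver Ω)) ≫ P) = A.translation P := by
  change (toUnit A.X ≫ toSpecOver (𝟙_ (SchemeOver Ω)) ≫ P) * 𝟙 A.X = (toSpecOver A.X ≫ P) * 𝟙 A.X
  rw [← Category.assoc, eq_toSpecOver' (toUnit A.X ≫ toSpecOver (𝟙_ (SchemeOver Ω)))]

/-- `toUnit T ≫ (𝟙_ → Spec Ω) ≫ P = toSpecOver T ≫ P`: the constant `T`-point at `P` in the two models of the base.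
[cite: MumfordFogartyKirwan1994, Ch. 7 §2 Definition 7.1 (p. 129)] -/
theorem toUnit_comp_toSpecOver_comp {X : SchemeOver Ω} (T : SchemeOver Ω) (P : AlgPoints X Ω) :
    toUnit T ≫ toSpecOver (𝟙_ (SchemeOver Ω)) ≫ P = toSpecOver T ≫ P := by
  rw [← Category.assoc, eq_toSpecOver' (toUnit T ≫ toSpecOver (𝟙_ (SchemeOver Ω)))]

/-! ## §2 Translations by non-trivial sections have no fixed geometric points -/

/-- **Freeness of the translation action in the points form** (the `hfree` binder of the ★ quotient files): for an abelian variety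
over `Ω`, seen as an abelian scheme over `Spec Ω`, and a section `σ ≠ 1`, no geometric point `x : Spec Ω′ → A` satisfies
`x ≫ t_σ = x` — `x ≫ t_σ = σ(x) · x` (★ `AbelianSchemeOver.comp_translation`), so `σ` restricted along the EPIMORPHISM
`Spec Ω′ → Spec Ω` (★ `epi_of_hom_spec_field`) is trivial, hence `σ = 1`. [cite: MumfordAV1970, §7 Thm. 4 (p. 72)]
[cite: MumfordFogartyKirwan1994, Ch. 7 §2 Definition 7.1 (p. 129)] -/
theorem comp_translation_left_ne_of_ne_one (A : AbelianVariety Ω) (K : Subgroup (AbelianSchemeOver.ofAbelianVariety A).Sections)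
    (Ω' : Type u) [Field Ω'] [IsAlgClosed Ω'] (x : Spec (.of Ω') ⟶ (AbelianSchemeOver.ofAbelianVariety A).left) (σ : K)
    (hσ : σ ≠ 1) : x ≫ ((AbelianSchemeOver.ofAbelianVariety A).translation (σ : (AbelianSchemeOver.ofAbelianVariety A).Sections)).left ≠ x := by
  intro hx
  apply hσ
  -- the point `x̄ : Spec Ω′ → A` over `Spec Ω`
  let T : Over (Spec (.of Ω)) := Over.mk (x ≫ (AbelianSchemeOver.ofAbelianVariety A).X.hom)
  let xbar : T ⟶ (AbelianSchemeOver.ofAbelianVariety A).X := Over.homMk x rfl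
  have h1 : xbar ≫ (AbelianSchemeOver.ofAbelianVariety A).translation
      (σ : (AbelianSchemeOver.ofAbelianVariety A).Sections) = xbar :=
    Over.OverMorphism.ext (by
      change x ≫ ((AbelianSchemeOver.ofAbelianVariety A).translation
        (σ : (AbelianSchemeOver.ofAbelianVariety A).Sections)).left = x
      exact hx)
  rw [AbelianSchemeOver.comp_translation] at h1
  -- `σ(x̄) = 1`
  have h2 : toUnit T ≫ (σ : (AbelianSchemeOver.ofAbelianVariety A).Sections) =
      toUnit T ≫ (1 : 𝟙_ (Over (Spec (.of Ω))) ⟶ (AbelianSchemeOver.ofAbelianVariety A).X) := by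
    rw [MonObj.comp_one]; exact mul_eq_right.mp h1
  -- `Spec Ω′ → Spec Ω` is an epimorphism
  haveI : Epi (toUnit T).left := AbelianVariety.epi_of_hom_spec_field (F := Ω) (Ω := Ω') _
  have h3 : ((σ : (AbelianSchemeOver.ofAbelianVariety A).Sections)).left =
      (1 : 𝟙_ (Over (Spec (.of Ω))) ⟶ (AbelianSchemeOver.ofAbelianVariety A).X).left := by
    rw [← cancel_epi (toUnit T).left, ← Over.comp_left, ← Over.comp_left, h2]
  exact Subtype.ext (Over.OverMorphism.ext h3)

/-! ## §3 The descent `π : A/K → A` of `[2]` along `ψ : A → A/K`, `K = A[2]`, is an isomorphism -/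

section Quotient

variable [IsAlgClosed Ω] [CharZero Ω] (A : AbelianVariety Ω)

/-- `A[2](Ω)` is finite. [cite: MumfordAV1970, §6 Application 3 (Proposition p. 64)] -/
private theorem finite_twoTorsion : Finite (A.torsionPoints Ω 2) := by
  apply Nat.finite_of_card_ne_zero
  rw [A.natCard_torsionPoints_eq_of_isAlgClosed Ω 2 (by exact_mod_cast (two_ne_zero : (2 : Ω) ≠ 0))]
  exact pow_ne_zero _ (by decide)

/-- **A descent of `[2]` through a quotient killing exactly `A[2]` is an ISOMORPHISM.**  Let `ψ : A → B` be a morphism of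
`Ω`-schemes (`A` an abelian variety over the algebraically closed `Ω` of characteristic `0`, `B` integral, locally of finite type)
which is onto on `Ω`-points and whose fibres on `Ω`-points are `A[2](Ω)`-cosets (`hψ`), and `π : B → A` with `ψ ≫ π = [2]` and
`π` proper.  Then `π` is bijective on `Ω`-points — onto since `[2]` is (★ `exists_pow_eq_of_isAlgClosed`), one-to-one since
`x₁² = x₂²` gives `x₁ = (x₁x₂⁻¹)·x₂` with `x₁x₂⁻¹ ∈ A[2](Ω)` — hence an isomorphism (★ `isIso_of_bijective_of_isProper_of_smooth`).
[cite: MumfordAV1970, §7 Thm. 4 (p. 72)] [cite: GortzWedhorn2023, Prop. 27.186 and Prop. 27.187] -/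
theorem isIso_of_comp_eq_pow_two {B : SchemeOver Ω} [IsIntegral B.left] [LocallyOfFiniteType B.hom] (ψ : A.X ⟶ B) (π : B ⟶ A.X)
    [IsProper π.left] (hcomp : ψ ≫ π = (𝟙 A.X) ^ 2) (hsurj : Function.Surjective (AlgPoints.map (L := Ω) ψ))
    (hψ : ∀ x₁ x₂ : A.Points Ω, x₁ * x₂⁻¹ ∈ A.torsionPoints Ω 2 → AlgPoints.map ψ x₁ = AlgPoints.map ψ x₂) : IsIso π := by
  haveI : Smooth A.X.hom := A.smooth_hom
  refine isIso_of_bijective_of_isProper_of_smooth (K := Ω) π ⟨?_, ?_⟩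
  · -- injective
    intro q₁ q₂ h
    obtain ⟨x₁, rfl⟩ := hsurj q₁
    obtain ⟨x₂, rfl⟩ := hsurj q₂
    apply hψ
    have hsq : ∀ x : A.Points Ω, AlgPoints.map π (AlgPoints.map ψ x) = x ^ 2 := fun x => by
      rw [← AlgPoints.map_comp_apply, hcomp, AlgPoints.map_apply, MonObj.comp_pow, Category.comp_id]
    have h' : x₁ ^ 2 = x₂ ^ 2 := by rw [← hsq, ← hsq, h]
    rw [AbelianVariety.mem_torsionPoints_iff, zpow_ofNat, mul_pow, inv_pow, h', mul_inv_cancel]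
  · -- surjective
    intro Q
    obtain ⟨R, hR⟩ := A.exists_pow_eq_of_isAlgClosed 2 (by exact_mod_cast (two_ne_zero : (2 : Ω) ≠ 0)) Q
    refine ⟨AlgPoints.map ψ R, ?_⟩
    rw [← AlgPoints.map_comp_apply, hcomp, AlgPoints.map_apply, MonObj.comp_pow, Category.comp_id, hR]

end Quotient

/-! ## §4 The theorem -/

open CartierDivisor in
/-- **AN EFFECTIVE DIVISOR INVARIANT UNDER THE `2`-TORSION TRANSLATIONS IS `[2]^*Θ₀` up to linear equivalence** ([MumfordAV1970] §23
Thm. 3 (p. 231), `n = 2`, second half; here over an algebraically closed field of characteristic `0`).  For an effective Cartier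
divisor `E` on the abelian variety `A` with `(t_x^*E).SameDivisor E` for every `x ∈ A[2](Ω)` there is a Cartier divisor `Θ₀` with
`([2]^*Θ₀).LinEquiv E`: descend `E` along the free quotient `ψ : A → A/A[2]` (★ `CartierDivisor.exists_sameDivisor_pullback_of_isGeometricQuotient`,
[MumfordAV1970] §12 Thm. 1) to `E₀`, and pull back along the inverse of the isomorphism `π : A/A[2] ⥲ A` with `ψ ≫ π = [2]`
([MumfordAV1970] §7 Thm. 4; §3).  The `IsDominant` instance of `[2] = Hom.toSchemeHom ((2 : ℤ) • 𝟙 A)` is a binder (★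
`AbelianVariety.isDominant_toSchemeHom_zsmul_of_ne_zero`). [cite: MumfordAV1970, §23 Thm. 3 (p. 231) and §7 Thm. 4 (p. 72)]
[cite: MumfordAV1970, §12 Thm. 1 (p. 112)] -/
theorem _root_.Literature.AlgebraicGeometry.Motives.AbelianVariety.exists_linEquiv_pullback_two_of_forall_twoTorsion_sameDivisor
    [IsAlgClosed Ω] [CharZero Ω] (A : AbelianVariety Ω) [IsDominant (AbelianVariety.Hom.toSchemeHom ((2 : ℤ) • 𝟙 A))]
    (E : CartierDivisor A.X.left) (hE : E.IsEffective)
    (hinv : ∀ x ∈ A.torsionPoints Ω 2, (E.pullback (A.translation x).left).SameDivisor E) :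
    ∃ Θ₀ : CartierDivisor A.X.left, (Θ₀.pullback (AbelianVariety.Hom.toSchemeHom ((2 : ℤ) • 𝟙 A))).LinEquiv E := by
  classical
  -- `A` as an abelian scheme over `S = Spec Ω`, `u = 𝟙 : S → S`
  set 𝔄 := AbelianSchemeOver.ofAbelianVariety A with h𝔄
  haveI : IsCommMonObj 𝔄.X := A.instIsCommMonObj
  haveI : IsIntegral 𝔄.X.left := (inferInstance : IsIntegral A.X.left)
  let u : Spec (.of Ω) ⟶ Spec (.of Ω) := 𝟙 _
  haveI : IsSeparated (𝔄.X.hom ≫ u) := by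
    change IsSeparated (A.X.hom ≫ 𝟙 _); rw [Category.comp_id]; infer_instance
  haveI : LocallyOfFiniteType (𝔄.X.hom ≫ u) := by
    change LocallyOfFiniteType (A.X.hom ≫ 𝟙 _); rw [Category.comp_id]; infer_instance
  -- the `2`-torsion sections `K`
  let sec : A.Points Ω →* 𝔄.Sections :=
    { toFun := fun P => toSpecOver (𝟙_ (SchemeOver Ω)) ≫ P
      map_one' := MonObj.comp_one _
      map_mul' := fun P Q => MonObj.comp_mul _ _ _ }
  let K : Subgroup 𝔄.Sections := (A.torsionPoints Ω 2).map sec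
  haveI : Finite (A.torsionPoints Ω 2) := finite_twoTorsion A
  haveI : Finite K := by
    change Finite ((A.torsionPoints Ω 2).map sec : Set 𝔄.Sections)
    rw [Subgroup.coe_map]
    exact (Set.toFinite _).image _ |>.to_subtype
  have hK : ∀ σ : K, (σ : 𝔄.Sections) ^ 2 = 1 := by
    rintro ⟨σ, hσ⟩
    obtain ⟨P, hP, rfl⟩ := Subgroup.mem_map.1 hσ
    change sec P ^ 2 = 1
    rw [← map_pow, ← zpow_ofNat, (AbelianVariety.mem_torsionPoints_iff 2 P).1 hP, map_one]
  have hfree : ∀ (Ω' : Type u) [Field Ω'] [IsAlgClosed Ω'] (x : Spec (.of Ω') ⟶ 𝔄.left) (σ : K), σ ≠ 1 →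
      x ≫ (𝔄.translation (σ : 𝔄.Sections)).left ≠ x :=
    fun Ω' _ _ x σ hσ => comp_translation_left_ne_of_ne_one A K Ω' x σ hσ
  -- the quotient `ψ : A → A/K` and its ★ properties
  have hqp : Literature.AlgebraicGeometry.HodgeTheory.IsQuasiProjectiveOver (Over.mk (𝔄.X.hom ≫ u) : SchemeOver Ω) := by
    have e : (Over.mk (𝔄.X.hom ≫ u) : SchemeOver Ω) = A.X := by
      change Over.mk (A.X.hom ≫ 𝟙 _) = A.X; rw [Category.comp_id]; rfl
    rw [e]
    exact Literature.AlgebraicGeometry.HodgeTheory.IsQuasiProjectiveOver.of_isProjectiveOver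
      (AbelianVariety.isProjectiveOver_holds A)
  have hcov := 𝔄.translationActionOver_hcov_of_isQuasiProjectiveOver u K hqp
  have hG := 𝔄.exists_grpObj_isMonHom_quotientMk u K hcov hfree
  have hsm : Smooth (𝔄.quotientOver u K).hom := 𝔄.smooth_quotientOver_hom_of_hom_spec u K hcov (𝟙 _) hfree
  have hgc := 𝔄.geometricallyConnected_quotientOver_hom u K hcov
  let B : AbelianSchemeOver (Spec (.of Ω)) := 𝔄.quotientBy u K hcov hG hsm hgc
  let ψ : 𝔄.X ⟶ 𝔄.quotientOver u K := 𝔄.quotientMk u K hcov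
  let ρ := 𝔄.quotientActionOver u K hcov
  have hq : ρ.IsGeometricQuotient ψ.left := 𝔄.isGeometricQuotient_quotientActionOver u K hcov
  have hfreeCHR := 𝔄.quotientActionOver_free u K hcov hfree
  haveI : Flat ψ.left := 𝔄.flat_quotientMk_left u K hcov hfree
  haveI : IsAffineHom ψ.left := 𝔄.isAffineHom_quotientMk_left u K hcov
  haveI : Surjective ψ.left := ⟨𝔄.quotientMk_left_surjective u K hcov⟩
  haveI : IsDominant ψ.left := ⟨(𝔄.quotientMk_left_surjective u K hcov).denseRange⟩
  haveI : IsIntegral (𝔄.quotientOver u K).left := (inferInstance : IsIntegral B.toAffine.toAbelianVariety.X.left)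
  haveI : LocallyOfFiniteType (𝔄.quotientOver u K).hom := 𝔄.locallyOfFiniteType_quotientOver_hom u K hcov
  -- `E` is invariant under the translations by the sections in `K`
  have hinv' : ∀ g : K, (E.pullback (ρ.aut g).hom).SameDivisor E := by
    rintro ⟨σ, hσ⟩
    obtain ⟨P, hP, rfl⟩ := Subgroup.mem_map.1 hσ
    have e : (ρ.aut ⟨sec P, hσ⟩).hom = (A.translation P).left := by
      rw [AbelianSchemeOver.quotientActionOver_aut_hom]
      exact congrArg CommaMorphism.left (translation_toSpecOver_comp A P)
    exact (E.pullback_congr_sameDivisor e).trans (hinv P hP)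
  -- descend `E` along `ψ`
  obtain ⟨E₀, -, hE₀⟩ := E.exists_sameDivisor_pullback_of_isGeometricQuotient ρ hq hfreeCHR hE hinv'
  -- `π : A/K → A` with `ψ ≫ π = [2]`, an isomorphism
  let π : 𝔄.quotientOver u K ⟶ 𝔄.X := 𝔄.mulNDesc u K hK hcov
  have hψπ : ψ ≫ π = (𝟙 𝔄.X) ^ 2 := 𝔄.quotientMk_comp_mulNDesc u K hK hcov
  haveI : IsSeparated 𝔄.X.hom := (inferInstance : IsSeparated A.X.hom)
  haveI : LocallyOfFiniteType 𝔄.X.hom := (inferInstance : LocallyOfFiniteType A.X.hom)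
  haveI : IsProper π.left := by
    haveI : IsProper (π.left ≫ 𝔄.X.hom) := by rw [Over.w π]; exact 𝔄.isProper_quotientOver_hom u K hcov
    exact IsProper.of_comp π.left 𝔄.X.hom
  haveI : IsIso π := by
    refine isIso_of_comp_eq_pow_two A ψ π hψπ ?_ ?_
    · exact AlgPoints.map_surjective_of_surjective_of_isAlgClosed' (L := Ω) ψ
    · intro x₁ x₂ hx
      -- `x₁ = t_σ x₂` with `σ = x₁ x₂⁻¹ ∈ K`, and `t_σ ≫ ψ = ψ`
      have hmem : sec (x₁ * x₂⁻¹) ∈ K := Subgroup.mem_map_of_mem sec hx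
      have ht : AlgPoints.map (𝔄.translation (sec (x₁ * x₂⁻¹))) x₂ = x₁ := by
        have hc := AbelianSchemeOver.comp_translation 𝔄 x₂ (sec (x₁ * x₂⁻¹))
        rw [AlgPoints.map_apply]
        refine hc.trans ?_
        change (toUnit (specOver Ω Ω) ≫ toSpecOver (𝟙_ (SchemeOver Ω)) ≫ (x₁ * x₂⁻¹)) * x₂ = x₁
        rw [toUnit_comp_toSpecOver_comp, ← eq_toSpecOver' (𝟙 (specOver Ω Ω)), Category.id_comp,
          inv_mul_cancel_right]
      rw [← ht, ← AlgPoints.map_comp_apply]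
      exact congrArg (fun φ => AlgPoints.map φ x₂) (𝔄.translation_comp_quotientMk u K hcov ⟨_, hmem⟩)
  -- `Θ₀ := (π⁻¹)^* E₀`
  refine ⟨E₀.pullback (inv π).left, ?_⟩
  have h2 : AbelianVariety.Hom.toSchemeHom ((2 : ℤ) • 𝟙 A) = (ψ ≫ π).left := by
    change ((2 : ℤ) • 𝟙 A).hom.hom.hom.left = _
    rw [AbelianVariety.hom_zsmul_id, hψπ, ← zpow_ofNat]
    rfl
  haveI : IsDominant (ψ ≫ π).left := by rw [← h2]; infer_instance
  haveI : IsDominant ((ψ ≫ π).left ≫ (inv π).left) := inferInstance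
  have hid : (ψ ≫ π).left ≫ (inv π).left = ψ.left := by
    rw [← Over.comp_left, Category.assoc, IsIso.hom_inv_id, Category.comp_id]
  exact (((E₀.pullback (inv π).left).pullback_congr_sameDivisor h2).trans
    (((E₀.pullback_pullback_sameDivisor (inv π).left (ψ ≫ π).left).trans (E₀.pullback_congr_sameDivisor hid)).trans
      hE₀)).linEquiv

end Literature.AlgebraicGeometry.AbelianVarieties

end
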